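import Mathlib
import HarnessLib
import Literature.Probability.Percolation.Percolation
import Literature.Probability.Percolation.TwoPointFunction
import Summits.CriticalPhenomena.PercolationContinuityZ3.Theses.PercTreeValue

/-!
# Sketch — crux-ideate stmt-CriticalPhenomena-7801 (TetrahedronLogConvexity), round 2, ideator 5

First lemmas of the idea card `mirror-plane-rp` (reflection positivity through the tetrahedron's
own mirror plane), stated over existing declarations so that they elaborate. Nothing is proved here
(`def … : Prop` only); `MirrorReflectionPositivity`, `MirrorRPSizeBias` and `OddsRatioIdentity` are
claimed PROVABLE NOW (product structure of `bondPercolation` + Cauchy–Schwarz), `MirrorRPNonDegeneracy`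
is the open stub of the line.

Geometry: `T_r = {0, a_r, b_r, c_r}`, `a_r = (r,r,0)`, `b_r = (r,0,r)`, `c_r = (0,r,r)`. The lattice
reflection `θ(x₀,x₁,x₂) = (x₁,x₀,x₂)` fixes the plane `Π = {x₀ = x₁}` POINTWISE; `0, a_r ∈ Π`,
`θ b_r = c_r`. Every nearest-neighbour edge of `ℤ³` changes `x₀ - x₁` by `0` or `±1`, so each edge
lies in the closed half-space `H≥ = {x₁ ≤ x₀}` or in `H≤ = {x₀ ≤ x₁}` (plane edges — the `x₂`-edges
between plane sites — in both, and they are `θ`-fixed). Given the plane edges, the configurations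
on the two open half-spaces are independent and `θ`-images of each other: this is reflection
positivity of the product measure, a NEAREST-NEIGHBOUR fact (a bond of range ≥ 2 can cross `Π`
without touching it; the `1/|x-y|²` chain has no such structure).
-/

namespace Summit.CriticalPhenomena.PercolationContinuityZ3.Cruxes.TetrahedronLogConvexity.Ideator5

open MeasureTheory
open Literature.Probability.Percolation Literature.Probability.LatticeModels

noncomputable section

/-! ## Geometry -/

def vA (r : ℕ) : Site 3 := ![(r : ℤ), (r : ℤ), 0]
def vB (r : ℕ) : Site 3 := ![(r : ℤ), 0, (r : ℤ)]
def vC (r : ℕ) : Site 3 := ![0, (r : ℤ), (r : ℤ)]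

/-- the mirror `θ`: swap the first two coordinates (fixes `0`, `a_r`; swaps `b_r ↔ c_r`). -/
def theta3 (x : Site 3) : Site 3 := ![x 1, x 0, x 2]

/-- `θ` acting on bond configurations. -/
def reflectCfg (ω : BondConfig (Site 3)) : BondConfig (Site 3) := Sym2.map theta3 ⁻¹' ω

/-- closed half-spaces of the mirror plane `Π = {x₀ = x₁}`. -/
def Hge : Set (Site 3) := {x | x 1 ≤ x 0}
def Hle : Set (Site 3) := {x | x 0 ≤ x 1}

/-- edges of the closed half-space `H≥` (both endpoints in `H≥`; includes the plane edges). -/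
def Ege : Set (Sym2 (Site 3)) := {e | ∀ x ∈ e, x ∈ Hge}

/-- a function of the configuration that only reads the edges of `E`. -/
def DeterminedOn (E : Set (Sym2 (Site 3))) (F : BondConfig (Site 3) → ℝ) : Prop :=
  ∀ ω ω' : BondConfig (Site 3), ω ∩ E = ω' ∩ E → F ω = F ω'

/-! ## Half-space-restricted pinning and capture events (the "relay-free sector") -/

/-- `A⁺_r = {0 ↔ a_r through open edges of the closed half-space x₁ ≤ x₀}`. -/
def Aup (r : ℕ) : Set (BondConfig (Site 3)) := openConnIn Hge 0 (vA r)
/-- `A⁻_r = θ A⁺_r = {0 ↔ a_r inside x₀ ≤ x₁}`. -/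
def Adn (r : ℕ) : Set (BondConfig (Site 3)) := openConnIn Hle 0 (vA r)
/-- `B⁺_r = {0 ↔ b_r inside x₁ ≤ x₀}` (capture of the apex `b_r`, which lies in the open half-space). -/
def Bup (r : ℕ) : Set (BondConfig (Site 3)) := openConnIn Hge 0 (vB r)
/-- `C⁻_r = θ B⁺_r = {0 ↔ c_r inside x₀ ≤ x₁}`. -/
def Cdn (r : ℕ) : Set (BondConfig (Site 3)) := openConnIn Hle 0 (vC r)
/-- the doubly-half-space pinning `D_r = A⁺_r ∩ A⁻_r ⊆ {0 ↔ a_r}`. -/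
def Dpin (r : ℕ) : Set (BondConfig (Site 3)) := Aup r ∩ Adn r

/-- **REFLECTION POSITIVITY of nearest-neighbour Bernoulli percolation through the lattice plane
`{x₀ = x₁}`** (claimed provable now): for bounded measurable `F, G` reading only edges of the closed
half-space `H≥`, the bilinear form `⟨F, G⟩ = E_p[F · (G ∘ θ)]` is positive semidefinite, hence
Cauchy–Schwarz. Proof: `E[F·(G∘θ)] = E[ E[F | plane] · E[G | plane] ]` by independence of the two open
half-spaces given the plane edges and `θ`-invariance of `bondPercolation (zdGraph 3) p` with `θ`
fixing every plane edge. -/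
def MirrorReflectionPositivity : Prop :=
  ∀ (p : unitInterval) (F G : BondConfig (Site 3) → ℝ),
    Measurable F → Measurable G → (∃ C : ℝ, ∀ ω, |F ω| ≤ C) → (∃ C : ℝ, ∀ ω, |G ω| ≤ C) →
    DeterminedOn Ege F → DeterminedOn Ege G →
    (∫ ω, F ω * G (reflectCfg ω) ∂(bondPercolation (zdGraph 3) p)) ^ 2 ≤
      (∫ ω, F ω * F (reflectCfg ω) ∂(bondPercolation (zdGraph 3) p)) *
        (∫ ω, G ω * G (reflectCfg ω) ∂(bondPercolation (zdGraph 3) p))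

/-- **FIRST LEMMA (card `mirror-plane-rp`; claimed provable now from `MirrorReflectionPositivity` with
`F = 1_{A⁺ ∩ B⁺}`, `G = 1_{A⁺}`): the size-bias / log-convexity inequality of the crux's exact shape
holds with constant `1` in the relay-free sector, at EVERY `p` and EVERY `r`:**
`P(D_r ∩ B⁺_r)² ≤ P(D_r ∩ B⁺_r ∩ C⁻_r) · P(D_r)`, i.e.
`Φ_RP(r,p) := P(D B⁺ C⁻) P(D) / P(D B⁺)² ≥ 1` ("given the double half-space pinning of `0, a_r`, the
half-space captures of the mirror apexes `b_r`, `c_r` are positively correlated"). Its excess is a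
variance: `Φ_RP − 1 = E[(g h' − g' h)²] / (2 E[g h]²)` with `h = P(A⁺ | plane)`, `g = P(A⁺ ∩ B⁺ | plane)`
and `(g', h')` an independent copy — no lopsidedness term, because the certificate (the plane
configuration) is pointwise `θ`-fixed. -/
def MirrorRPSizeBias : Prop :=
  ∀ (p : unitInterval) (r : ℕ),
    ((bondPercolation (zdGraph 3) p).real (Dpin r ∩ Bup r)) ^ 2 ≤
      (bondPercolation (zdGraph 3) p).real (Dpin r ∩ Bup r ∩ Cdn r) *
        (bondPercolation (zdGraph 3) p).real (Dpin r)

/-- **The open stub of the line (RP non-degeneracy at `p_c`)**: the RP excess of the relay-free sector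
stays bounded away from `0` — the plane configuration modulates the conditional half-space capture
`ρ = P(B⁺ | A⁺, plane)` non-trivially in `L²`, uniformly in `r`. A statement inside HALF-SPACE
percolation at `p_c(ℤ³)`, where `θ_H(p_c) = 0` is Barsky–Grimmett–Newman's theorem, so it is NOT
conjunct-strong; jump value unknown (not claimed to be `1`). -/
def MirrorRPNonDegeneracy : Prop :=
  ∃ δ : ℝ, 0 < δ ∧ ∃ r₀ : ℕ, ∀ r : ℕ, r₀ ≤ r →
    (1 + δ) * ((bondPercolation (zdGraph 3) (criticalProbI 3)).real (Dpin r ∩ Bup r)) ^ 2 ≤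
      (bondPercolation (zdGraph 3) (criticalProbI 3)).real (Dpin r ∩ Bup r ∩ Cdn r) *
        (bondPercolation (zdGraph 3) (criticalProbI 3)).real (Dpin r)

/-! ## Normal form of the crux used by the card (bookkeeping, every graph, every `p`) -/

def E2 (r : ℕ) : Set (BondConfig (Site 3)) := openConn 0 (vA r)
def E3b (r : ℕ) : Set (BondConfig (Site 3)) := openConn 0 (vA r) ∩ openConn 0 (vB r)
def E3c (r : ℕ) : Set (BondConfig (Site 3)) := openConn 0 (vA r) ∩ openConn 0 (vC r)
def E4 (r : ℕ) : Set (BondConfig (Site 3)) := openConn 0 (vA r) ∩ openConn 0 (vB r) ∩ openConn 0 (vC r)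

/-- **Odds-ratio identity** (exact, `Cov = p₁₁p₀₀ − p₁₀p₀₁` for a pair of indicators under
`P(· | 0 ↔ a_r)`): `P(0abc)·τ(0,a) − P(0ab)·P(0ac) = P(0abc)·P(0a, b∉C, c∉C) − P(0ab, c∉C)·P(0ac, b∉C)`.
So the crux reads `(11)(00) ≥ (10)(01) + δ·P(0ab)P(0ac)`: the single "upper" FKG-lattice (MTP₂)
inequality of the pinned-connection triple `(1_{0a}, 1_{0b}, 1_{0c})` — the "lower" ones
(`x ∧ y` without the pin) are van den Berg–Häggström–Kahn's Thm 1.3 on every graph, the mixed ones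
hold with a polynomial margin by Harris, and this one is false on the 4-cycle. The RP sector
`MirrorRPSizeBias` is the one sector of `ℤ³` where it is a theorem. -/
def OddsRatioIdentity : Prop :=
  ∀ (p : unitInterval) (r : ℕ),
    (bondPercolation (zdGraph 3) p).real (E4 r) * (bondPercolation (zdGraph 3) p).real (E2 r) -
        (bondPercolation (zdGraph 3) p).real (E3b r) * (bondPercolation (zdGraph 3) p).real (E3c r) =
      (bondPercolation (zdGraph 3) p).real (E4 r) *
          (bondPercolation (zdGraph 3) p).real (E2 r ∩ (openConn 0 (vB r))ᶜ ∩ (openConn 0 (vC r))ᶜ) -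
        (bondPercolation (zdGraph 3) p).real (E3b r ∩ (openConn 0 (vC r))ᶜ) *
          (bondPercolation (zdGraph 3) p).real (E3c r ∩ (openConn 0 (vB r))ᶜ)

/-- **A rigorous reverse-direction by-product** (claimed provable now, `MirrorReflectionPositivity`
with `F = 1_{A⁺ ∩ B⁺}`, `G = 1`): a four-point connectivity is bounded BELOW by the square of a
(half-space) three-point connectivity, `P_p(0 ↔ a_r ↔ b_r ↔ c_r) ≥ P_p(0 ↔ a_r ↔ b_r inside x₁ ≤ x₀)²`,
on `ℤ³` for every `p` — the only lower tree-type bound in the record (polynomially weak in the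
continuous world, because the right side pays boundary exponents). -/
def FourPointReverseBound : Prop :=
  ∀ (p : unitInterval) (r : ℕ),
    ((bondPercolation (zdGraph 3) p).real (Aup r ∩ Bup r)) ^ 2 ≤
      (bondPercolation (zdGraph 3) p).real (E4 r)


/-! ## The fork handed to the route planners (not a claim of this card): Φ_RP as a detector with reversed roles -/

/-- **(S) MirrorSaturation** — the RP bound is asymptotically saturated at `p_c` (continuous-side
statement; a CONCENTRATION inequality for the plane-conditioned capture ratio; numerically
`Φ_RP = 1.00 ± 0.01` at `r ≤ 5`, kit j022246). Division-free: `∀ ε > 0, ∃ r₀, ∀ r ≥ r₀,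
P(D B⁺ C⁻)·P(D) ≤ (1+ε)·P(D B⁺)²`. -/
def MirrorSaturation : Prop :=
  ∀ ε : ℝ, 0 < ε → ∃ r₀ : ℕ, ∀ r : ℕ, r₀ ≤ r →
    (bondPercolation (zdGraph 3) (criticalProbI 3)).real (Dpin r ∩ Bup r ∩ Cdn r) *
        (bondPercolation (zdGraph 3) (criticalProbI 3)).real (Dpin r) ≤
      (1 + ε) * ((bondPercolation (zdGraph 3) (criticalProbI 3)).real (Dpin r ∩ Bup r)) ^ 2

/-- **(J) MirrorSaturationGap** — jump-side conjecture-question: a bulk jump de-saturates the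
mirror sector (the plane's columns decide mergers of the macroscopic half-space pieces of `C_∞`).
OPEN in both directions; if true, `MirrorSaturation ∧ MirrorSaturationGap → θ(p_c) = 0` is two
lines, with no amplitude LOWER bound anywhere. -/
def MirrorSaturationGap : Prop :=
  Literature.Probability.Percolation.theta (zdGraph 3) (0 : Site 3) (criticalProbI 3) ≠ 0 →
    ∃ c : ℝ, 0 < c ∧ ∃ r₀ : ℕ, ∀ r : ℕ, r₀ ≤ r →
      (1 + c) * ((bondPercolation (zdGraph 3) (criticalProbI 3)).real (Dpin r ∩ Bup r)) ^ 2 ≤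
        (bondPercolation (zdGraph 3) (criticalProbI 3)).real (Dpin r ∩ Bup r ∩ Cdn r) *
          (bondPercolation (zdGraph 3) (criticalProbI 3)).real (Dpin r)

/-- the two-line assembly of the fork (bookkeeping; stated, not proved here). -/
def MirrorForkAssembly : Prop :=
  MirrorSaturation → MirrorSaturationGap →
    Literature.Probability.Percolation.theta (zdGraph 3) (0 : Site 3) (criticalProbI 3) = 0

/-- sanity: the sketch's four-point event is the crux's. -/
example (r : ℕ) : E4 r = openConn 0 ![(r : ℤ), (r : ℤ), 0] ∩ openConn 0 ![(r : ℤ), 0, (r : ℤ)] ∩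
    openConn 0 ![0, (r : ℤ), (r : ℤ)] := rfl

/-- the crux decl is in scope (typing check only). -/
example : Prop := Summit.CriticalPhenomena.PercolationContinuityZ3.Theses.PercTreeValue.TetrahedronLogConvexity

end

end Summit.CriticalPhenomena.PercolationContinuityZ3.Cruxes.TetrahedronLogConvexity.Ideator5
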